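import Summits.CriticalPhenomena.CardyFormulaZ2.Theorems.CardyBoundaryCoulombGasStripClusterRatesQuasiMultRate

/-!
# Crux `StripClusterRates` (stmt-CriticalPhenomena-13878), line two-cluster-rate-is-stationary-gap, reshape 5 (lead c6):
the real-analysis step of the confined-gluing order transfer

Support file (`--supports stmt-CriticalPhenomena-13878`). A super-multiplicative (up to a constant, with a gap) MINORANT
`f ≤ p` bounds the exponential rate of `p` from ABOVE (mirror image of `qm_rate_le_finite`, which needs quasi-multiplicativity of
`p` itself): this is what lets the lead replace two-cluster quasi-multiplicativity (QM₂) by the gluing of PRE-SEPARATED block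
events in the γ₂-half of the crux. See `Cruxes/StripClusterRates/Lines/two_cluster_rate_is_stationary_gap.lean`, section
`ConfinedGluing`.
-/

noncomputable section

open Filter Topology

namespace Summit.CriticalPhenomena.CardyFormulaZ2.Cruxes.StripClusterRates.TwoClusterRateIsStationaryGap

/-- The block subsequence `k ↦ k·L + M` tends to infinity (`1 ≤ L`). [folklore] -/
theorem cg4_tendsto_blocks {L : ℕ} (hL : 1 ≤ L) (M : ℕ) :
    Tendsto (fun k : ℕ ↦ k * L + M) atTop atTop := by
  refine tendsto_atTop_mono (fun k ↦ ?_) tendsto_id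
  simp only [id]
  nlinarith

/-- **CG4 · Fekete from below with a gap** (registered helper `cg_rate_le_of_supermul` of crux `StripClusterRates`,
line two-cluster-rate-is-stationary-gap, reshape 5): if `0 ≤ f`, `f ≤ p` beyond `M₀`, `c · f(M₁) f(M₂) ≤ f(M₁+J+M₂)` beyond `M₀`
and `-log p(m)/m → γ`, then `γ ≤ (-log f(M) - log c)/(M+J)` for every `M ≥ M₀` with `f(M) > 0` — iterate the gluing along
`m_k = k(M+J) + M` and pass to the limit. In the order transfer `p = p₂(·, 3b+2)` and `f` = probability of the end-confined
three-arm block event. [folklore; cf. M. Fekete, Math. Z. 17 (1923)] -/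
theorem cg_rate_le_of_supermul :
    ∀ (p f : ℕ → ℝ) (c γ : ℝ) (J M₀ : ℕ), 0 < c → 1 ≤ M₀ → (∀ m, 0 < p m) → (∀ m, M₀ ≤ m → f m ≤ p m) → (∀ m, 0 ≤ f m) →
    (∀ M₁ M₂, M₀ ≤ M₁ → M₀ ≤ M₂ → c * f M₁ * f M₂ ≤ f (M₁ + J + M₂)) →
    Tendsto (fun m : ℕ ↦ -Real.log (p m) / (m : ℝ)) atTop (𝓝 γ) →
    ∀ M, M₀ ≤ M → 0 < f M → γ ≤ (-Real.log (f M) - Real.log c) / ((M : ℝ) + J) := by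
  intro p f c γ J M₀ hc hM₀ hp hfp hf0 hsup hγ M hM hfM
  set L : ℕ := M + J with hL
  have hL1 : 1 ≤ L := by omega
  -- iterated lower bound along the blocks `k * L + M`
  have hiter : ∀ k : ℕ, c ^ k * f M ^ (k + 1) ≤ f (k * L + M) := by
    intro k
    induction k with
    | zero => simp
    | succ k ih =>
      have hkM : M₀ ≤ k * L + M := le_trans hM (Nat.le_add_left _ _)
      have h := hsup (k * L + M) M hkM hM
      have heq : k * L + M + J + M = (k + 1) * L + M := by rw [hL]; ring
      rw [heq] at h
      have hfM0 : 0 ≤ f M := hf0 M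
      calc c ^ (k + 1) * f M ^ (k + 1 + 1) = c * (c ^ k * f M ^ (k + 1)) * f M := by ring
        _ ≤ c * f (k * L + M) * f M := by
            have := mul_le_mul_of_nonneg_left ih hc.le
            exact mul_le_mul_of_nonneg_right this hfM0
        _ ≤ f ((k + 1) * L + M) := h
  have hfpos : ∀ k : ℕ, 0 < f (k * L + M) := fun k ↦
    lt_of_lt_of_le (by positivity) (hiter k)
  -- logarithmic form
  have hlog : ∀ k : ℕ, -Real.log (p (k * L + M)) ≤
      (k : ℝ) * (-Real.log c) + ((k : ℝ) + 1) * (-Real.log (f M)) := by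
    intro k
    have hkM : M₀ ≤ k * L + M := le_trans hM (Nat.le_add_left _ _)
    have h1 : Real.log (f (k * L + M)) ≤ Real.log (p (k * L + M)) :=
      Real.log_le_log (hfpos k) (hfp _ hkM)
    have h2 : Real.log (c ^ k * f M ^ (k + 1)) ≤ Real.log (f (k * L + M)) :=
      Real.log_le_log (by positivity) (hiter k)
    rw [Real.log_mul (pow_pos hc k).ne' (pow_pos hfM _).ne', Real.log_pow, Real.log_pow] at h2
    push_cast at h2
    linarith
  -- the limit along the blocks
  have hblocks := cg4_tendsto_blocks hL1 M
  have hblocksR : Tendsto (fun k : ℕ ↦ ((k * L + M : ℕ) : ℝ)) atTop atTop :=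
    tendsto_natCast_atTop_atTop.comp hblocks
  have hsub : Tendsto (fun k : ℕ ↦ -Real.log (p (k * L + M)) / ((k * L + M : ℕ) : ℝ)) atTop (𝓝 γ) :=
    hγ.comp hblocks
  obtain ⟨a, ha⟩ : ∃ a : ℝ, a = -Real.log c := ⟨_, rfl⟩
  obtain ⟨d, hd⟩ : ∃ d : ℝ, d = -Real.log (f M) := ⟨_, rfl⟩
  have hMJ : (0 : ℝ) < (M : ℝ) + J := by
    have h1 : (1 : ℝ) ≤ M := by exact_mod_cast (le_trans hM₀ hM)
    have h2 : (0 : ℝ) ≤ J := Nat.cast_nonneg J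
    linarith
  obtain ⟨ℓ, hℓ⟩ : ∃ ℓ : ℝ, ℓ = (d + a) / ((M : ℝ) + J) := ⟨_, rfl⟩
  have hℓ' : ℓ * ((M : ℝ) + J) = d + a := by rw [hℓ]; exact div_mul_cancel₀ (d + a) hMJ.ne'
  have hLR : (L : ℝ) = (M : ℝ) + J := by rw [hL]; push_cast; ring
  have hg : Tendsto (fun k : ℕ ↦ ℓ + (d - ℓ * M) / ((k * L + M : ℕ) : ℝ)) atTop (𝓝 ℓ) := by
    have h := (tendsto_const_nhds (x := ℓ)).add ((tendsto_const_nhds (x := d - ℓ * M)).div_atTop hblocksR)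
    rw [add_zero] at h
    exact h
  have key : γ ≤ ℓ := by
    refine le_of_tendsto_of_tendsto' hsub hg fun k ↦ ?_
    have hpos : (0 : ℝ) < ((k * L + M : ℕ) : ℝ) := by
      have : 1 ≤ k * L + M := le_trans (le_trans hM₀ hM) (Nat.le_add_left _ _)
      exact_mod_cast this
    have hcast : ((k * L + M : ℕ) : ℝ) = (k : ℝ) * ((M : ℝ) + J) + M := by push_cast; rw [hLR]
    have hnum : (k : ℝ) * a + ((k : ℝ) + 1) * d = ℓ * ((k * L + M : ℕ) : ℝ) + (d - ℓ * M) := by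
      rw [hcast]
      linear_combination (-(k : ℝ)) * hℓ'
    have hlogk := hlog k
    rw [← ha, ← hd] at hlogk
    calc -Real.log (p (k * L + M)) / ((k * L + M : ℕ) : ℝ)
        ≤ ((k : ℝ) * a + ((k : ℝ) + 1) * d) / ((k * L + M : ℕ) : ℝ) :=
          div_le_div_of_nonneg_right hlogk hpos.le
      _ = ℓ + (d - ℓ * M) / ((k * L + M : ℕ) : ℝ) := by
          rw [hnum, add_div, mul_div_assoc, div_self hpos.ne', mul_one]
  have : ℓ = (-Real.log (f M) - Real.log c) / ((M : ℝ) + J) := by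
    rw [hℓ, hd, ha]; ring
  rw [← this]
  exact key


end Summit.CriticalPhenomena.CardyFormulaZ2.Cruxes.StripClusterRates.TwoClusterRateIsStationaryGap

end
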